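import Mathlib.Analysis.SpecialFunctions.ExpDeriv
import Mathlib.Analysis.SpecialFunctions.Log.Basic
import Mathlib.MeasureTheory.Integral.IntervalIntegral.FundThmCalculus
import Mathlib.MeasureTheory.Integral.IntervalIntegral.IntegrationByParts
import Mathlib.Analysis.Calculus.Deriv.MeanValue
import HarnessLib

/-!
# `MustSqueeze` — the backward Grönwall lemma with `L¹_unif` forcing

Helper file for item stmt-NavierStokesRegularity-11610 (route SqueezeCycle, crux `MustSqueeze`),
line leaky-quarter-law. A differentiable `Z : ℝ → ℝ` with

* the damped differential inequality `Z' ≤ −c Z + K` on all of `ℝ` (`c > 0`),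
* a forcing `K` whose unit-interval integrals are uniformly bounded, `∫_s^{s+1} |K| ≤ B`,
* and uniformly bounded unit-interval averages, `∫_s^{s+1} Z ≤ A`,

is uniformly bounded by the forcing alone: `Z(s) ≤ B / (1 − e^{−c})` for every `s`
(`backward_gronwall_bound`). Mechanism: `W(σ) = e^{cσ} Z(σ) − ∫₀^σ e^{cτ} K(τ) dτ` is
non-increasing, so going backward in time from `s₀` the quantity `e^{cσ} Z(σ)` can drop by at
most `∑ₖ e^{c(s₀−k)} B = e^{cs₀} B/(1 − e^{−c})`; if `Z(s₀)` exceeded that threshold, `Z` would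
grow exponentially as `σ → −∞`, contradicting the bounded averages. This is the scale-invariance
step of the localised quarter-law ("bounds uniform in `s` forbid backward exponentials").
-/

noncomputable section

open MeasureTheory Set Filter Real intervalIntegral
open scoped Topology

namespace Summit.NavierStokesRegularity.NavierStokesRegularity.Theorems

/-- Unit-interval bounds sum along the past: if `∫_s^{s+1} g ≤ e^{c(s+1)} B` for every `s`
(here `g ≥ 0` will be `e^{cτ}|K(τ)|`), then `∫_{s₀−n}^{s₀} g ≤ e^{cs₀} B ∑_{k<n} e^{−ck}`. [folklore] -/
theorem integral_le_geom_sum_of_unit_bounds {g : ℝ → ℝ} (hg : ∀ a b, IntervalIntegrable g volume a b)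
    {c B s₀ : ℝ} (hunit : ∀ s, ∫ τ in s..(s + 1), g τ ≤ Real.exp (c * (s + 1)) * B) (n : ℕ) :
    ∫ τ in (s₀ - n)..s₀, g τ ≤ Real.exp (c * s₀) * B * ∑ k ∈ Finset.range n, Real.exp (-c * k) := by
  induction n with
  | zero => simp
  | succ n ih =>
    have hsplit : ∫ τ in (s₀ - (n + 1 : ℕ))..s₀, g τ =
        (∫ τ in (s₀ - (n + 1 : ℕ))..(s₀ - n), g τ) + ∫ τ in (s₀ - n)..s₀, g τ :=
      (integral_add_adjacent_intervals (hg _ _) (hg _ _)).symm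
    have h1 : ∫ τ in (s₀ - (n + 1 : ℕ))..(s₀ - n), g τ ≤ Real.exp (c * (s₀ - n)) * B := by
      have h := hunit (s₀ - (n + 1 : ℕ))
      have e : s₀ - ((n + 1 : ℕ) : ℝ) + 1 = s₀ - n := by push_cast; ring
      rwa [e] at h
    rw [hsplit, Finset.sum_range_succ, mul_add]
    have e2 : Real.exp (c * s₀) * B * Real.exp (-c * n) = Real.exp (c * (s₀ - n)) * B := by
      have : c * (s₀ - n) = c * s₀ + -c * n := by ring
      rw [this, Real.exp_add]; ring
    linarith [ih, h1, e2]

/-- The geometric sum `∑_{k<n} e^{−ck} ≤ 1/(1 − e^{−c})` for `c > 0`. [folklore] -/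
theorem geom_sum_exp_neg_le {c : ℝ} (hc : 0 < c) (n : ℕ) :
    ∑ k ∈ Finset.range n, Real.exp (-c * k) ≤ 1 / (1 - Real.exp (-c)) := by
  have hq0 : 0 ≤ Real.exp (-c) := (Real.exp_pos _).le
  have hq1 : Real.exp (-c) < 1 := Real.exp_lt_one_iff.2 (by linarith)
  have e : ∀ k : ℕ, Real.exp (-c * k) = Real.exp (-c) ^ k := fun k => by
    rw [← Real.exp_nat_mul]; ring_nf
  simp_rw [e]
  rw [geom_sum_eq hq1.ne, ← neg_div_neg_eq, neg_sub, neg_sub]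
  exact div_le_div_of_nonneg_right (by linarith [pow_nonneg hq0 n]) (by linarith)

/-- **Backward Grönwall with `L¹_unif` forcing.** Let `c > 0`, `Z` differentiable with
`Z' ≤ −cZ + K` on `ℝ`, `K` continuous with `∫_s^{s+1}|K| ≤ B` for all `s`, and suppose the unit
averages `∫_s^{s+1} Z` are bounded uniformly in `s`. Then `Z(s) ≤ B/(1 − e^{−c})` for every `s`.
[folklore] -/
theorem backward_gronwall_bound {Z K : ℝ → ℝ} {c B : ℝ} (hc : 0 < c)
    (hZd : Differentiable ℝ Z) (hineq : ∀ s, deriv Z s ≤ -c * Z s + K s) (hK : Continuous K)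
    (hKB : ∀ s, ∫ σ in s..(s + 1), |K σ| ≤ B) (hZavg : ∃ A, ∀ s, ∫ σ in s..(s + 1), Z σ ≤ A)
    (s₀ : ℝ) : Z s₀ ≤ B / (1 - Real.exp (-c)) := by
  obtain ⟨A, hA⟩ := hZavg
  have hq1 : Real.exp (-c) < 1 := Real.exp_lt_one_iff.2 (by linarith)
  have h1q : 0 < 1 - Real.exp (-c) := by linarith
  have hB0 : 0 ≤ B := le_trans (intervalIntegral.integral_nonneg (by linarith) fun σ _ => abs_nonneg _) (hKB 0)
  -- the integrand `g = e^{cτ}|K|` and the primitive `P(σ) = ∫₀^σ e^{cτ} K`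
  set g : ℝ → ℝ := fun τ => Real.exp (c * τ) * |K τ| with hg
  have hgc : Continuous g := (Real.continuous_exp.comp (continuous_const.mul continuous_id)).mul
    (continuous_abs.comp hK)
  have hgi : ∀ a b, IntervalIntegrable g volume a b := fun a b => hgc.intervalIntegrable _ _
  set f : ℝ → ℝ := fun τ => Real.exp (c * τ) * K τ with hf
  have hfc : Continuous f := (Real.continuous_exp.comp (continuous_const.mul continuous_id)).mul hK
  set P : ℝ → ℝ := fun σ => ∫ τ in (0 : ℝ)..σ, f τ with hP
  have hPd : ∀ σ, HasDerivAt P (f σ) σ := fun σ =>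
    (hfc.integral_hasStrictDerivAt 0 σ).hasDerivAt
  -- `W = e^{cσ} Z − P` is non-increasing
  set W : ℝ → ℝ := fun σ => Real.exp (c * σ) * Z σ - P σ with hW
  have hWd : ∀ σ, HasDerivAt W (Real.exp (c * σ) * c * Z σ + Real.exp (c * σ) * deriv Z σ - f σ) σ := by
    intro σ
    have he : HasDerivAt (fun τ => Real.exp (c * τ)) (Real.exp (c * σ) * c) σ := by
      simpa using ((hasDerivAt_id σ).const_mul c).exp
    exact (he.mul (hZd σ).hasDerivAt).sub (hPd σ)
  have hWanti : Antitone W := by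
    refine antitone_of_deriv_nonpos (fun σ => (hWd σ).differentiableAt) fun σ => ?_
    rw [(hWd σ).deriv]
    have hexp : 0 < Real.exp (c * σ) := Real.exp_pos _
    have := mul_le_mul_of_nonneg_left (hineq σ) hexp.le
    rw [hf]
    nlinarith [this]
  -- unit bounds for `g`: `∫_s^{s+1} g ≤ e^{c(s+1)} B`
  have hunit : ∀ s, ∫ τ in s..(s + 1), g τ ≤ Real.exp (c * (s + 1)) * B := by
    intro s
    calc ∫ τ in s..(s + 1), g τ ≤ ∫ τ in s..(s + 1), Real.exp (c * (s + 1)) * |K τ| := by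
          refine intervalIntegral.integral_mono_on (by linarith) (hgi _ _)
            ((continuous_const.mul (continuous_abs.comp hK)).intervalIntegrable _ _) fun τ hτ => ?_
          exact mul_le_mul_of_nonneg_right (Real.exp_le_exp.2 (by nlinarith [hτ.2])) (abs_nonneg _)
      _ = Real.exp (c * (s + 1)) * ∫ τ in s..(s + 1), |K τ| := by
          rw [intervalIntegral.integral_const_mul]
      _ ≤ Real.exp (c * (s + 1)) * B := mul_le_mul_of_nonneg_left (hKB s) (Real.exp_pos _).le
  -- backward estimate: `e^{cσ} Z(σ) ≥ e^{cs₀} (Z(s₀) − B/(1−e^{−c}))` for `σ ≤ s₀`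
  have hback : ∀ σ, σ ≤ s₀ →
      Real.exp (c * s₀) * (Z s₀ - B / (1 - Real.exp (-c))) ≤ Real.exp (c * σ) * Z σ := by
    intro σ hσ
    have hWσ : W s₀ ≤ W σ := hWanti hσ
    -- `P s₀ − P σ = ∫_σ^{s₀} f ≤ ∫_σ^{s₀} g ≤ ∫_{s₀−n}^{s₀} g`
    have hPdiff : P s₀ - P σ = ∫ τ in σ..s₀, f τ := by
      rw [hP]
      simp only
      rw [intervalIntegral.integral_interval_sub_left (hfc.intervalIntegrable _ _) (hfc.intervalIntegrable _ _)]
    obtain ⟨n, hn⟩ : ∃ n : ℕ, s₀ - σ ≤ n := exists_nat_ge (s₀ - σ)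
    have hfg : ∫ τ in σ..s₀, f τ ≤ ∫ τ in σ..s₀, g τ :=
      intervalIntegral.integral_mono_on hσ (hfc.intervalIntegrable _ _) (hgi _ _) fun τ _ =>
        mul_le_mul_of_nonneg_left (le_abs_self _) (Real.exp_pos _).le
    have hgext : ∫ τ in σ..s₀, g τ ≤ ∫ τ in (s₀ - n)..s₀, g τ := by
      rw [← integral_add_adjacent_intervals (hgi (s₀ - n) σ) (hgi σ s₀)]
      have : 0 ≤ ∫ τ in (s₀ - n)..σ, g τ :=
        intervalIntegral.integral_nonneg (by linarith) fun τ _ => by positivity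
      linarith
    have hgeom := integral_le_geom_sum_of_unit_bounds hgi hunit n (s₀ := s₀) (c := c) (B := B)
    have hsum := geom_sum_exp_neg_le hc n
    have hchain : ∫ τ in σ..s₀, f τ ≤ Real.exp (c * s₀) * B * (1 / (1 - Real.exp (-c))) :=
      le_trans (le_trans hfg (le_trans hgext hgeom))
        (mul_le_mul_of_nonneg_left hsum (mul_nonneg (Real.exp_pos _).le hB0))
    have hWdef : W s₀ - W σ = Real.exp (c * s₀) * Z s₀ - Real.exp (c * σ) * Z σ - (P s₀ - P σ) := by
      rw [hW]; ring
    have : Real.exp (c * s₀) * Z s₀ - Real.exp (c * σ) * Z σ ≤ ∫ τ in σ..s₀, f τ := by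
      linarith [hWσ, hWdef, hPdiff]
    have e : Real.exp (c * s₀) * (Z s₀ - B / (1 - Real.exp (-c))) =
        Real.exp (c * s₀) * Z s₀ - Real.exp (c * s₀) * B * (1 / (1 - Real.exp (-c))) := by ring
    linarith
  -- contradiction if `Z s₀` exceeds the threshold
  by_contra hgt'
  have hgt := not_le.1 hgt'
  set δ : ℝ := Z s₀ - B / (1 - Real.exp (-c)) with hδ
  have hδpos : 0 < δ := by rw [hδ]; linarith
  -- exponential lower bound on unit averages in the past
  have havg : ∀ n : ℕ, δ * Real.exp (c * n) ≤ ∫ σ in (s₀ - n - 1)..(s₀ - n), Z σ := by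
    intro n
    have hle : ∀ σ ∈ Icc (s₀ - n - 1) (s₀ - n), δ * Real.exp (c * n) ≤ Z σ := by
      intro σ hσ
      have hσ₀ : σ ≤ s₀ := by linarith [hσ.2, (Nat.cast_nonneg n : (0 : ℝ) ≤ n)]
      have hb := hback σ hσ₀
      -- divide by `e^{cσ}` and use `s₀ − σ ≥ n`
      have hexpσ : 0 < Real.exp (c * σ) := Real.exp_pos _
      have hkey : δ * Real.exp (c * (s₀ - σ)) ≤ Z σ := by
        rw [show c * (s₀ - σ) = c * s₀ - c * σ by ring, Real.exp_sub, mul_div_assoc']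
        rw [div_le_iff₀ hexpσ]
        calc δ * Real.exp (c * s₀) = Real.exp (c * s₀) * (Z s₀ - B / (1 - Real.exp (-c))) := by
              rw [hδ]; ring
          _ ≤ Real.exp (c * σ) * Z σ := hb
          _ = Z σ * Real.exp (c * σ) := mul_comm _ _
      have hmono : Real.exp (c * n) ≤ Real.exp (c * (s₀ - σ)) :=
        Real.exp_le_exp.2 (by nlinarith [hσ.2])
      nlinarith [hmono, hδpos]
    have hmono := intervalIntegral.integral_mono_on (μ := volume) (by linarith) intervalIntegrable_const
      ((hZd.continuous).intervalIntegrable _ _) hle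
    have hconst : ∫ _ in (s₀ - n - 1)..(s₀ - n), δ * Real.exp (c * n) = δ * Real.exp (c * n) := by
      rw [intervalIntegral.integral_const, smul_eq_mul]; ring
    linarith [hmono, hconst]
  -- choose `n` with `δ e^{cn} > A`
  obtain ⟨n, hn⟩ : ∃ n : ℕ, A / (δ * c) < n := exists_nat_gt _
  have hexp : c * n + 1 ≤ Real.exp (c * n) := by linarith [Real.add_one_le_exp (c * n)]
  have h1 := havg n
  have h2 := hA (s₀ - n - 1)
  have e : s₀ - n - 1 + 1 = s₀ - n := by ring
  rw [e] at h2
  have hcn : A < δ * (c * n) := by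
    have := (div_lt_iff₀ (mul_pos hδpos hc)).1 hn
    linarith [this]
  nlinarith [h1, h2, hexp, hδpos, hcn]

end Summit.NavierStokesRegularity.NavierStokesRegularity.Theorems

end
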